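import Summits.QuantumFields.BalabanUV.Beta.GAN24.DirichletBoxTwoLevel
import Summits.QuantumFields.BalabanUV.T4Continuum.Support.CarrierColumnTrace

/-!
# T⁴ programme, spine node NE2 (U1a), sub-row Δ1 «NE2⁰-Dirichlet» — THE NEUMANN DIRECTION OF (P-gaffney): King's two-level window
# pairing in the OWN direction `ν` of the star carrier, masked to the `ν`-pairs inside the carrier, with the wall VALUE terms isolated

NE2 formalisation swarm `b2b-balaban-t4-ne2-formalise-*`, LEAF PROVER 03 (gen 8), item «W3-GAFFNEY-PAIRING» = (P-gaffney) for the
LOCAL operator (owner R35 (c) / O15-c, journal 2026-08-20 l.22128 / l.22472; CLAIM l.22258), file P3 (on P1 `AlignedCarrierTrace`,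
P3b `CarrierColumnTrace`; the transverse directions are P2 `AlignedCarrierPairing`).

WHAT.  Coarse level `N`, refinement `R` (= `L`), component/direction `ν`, star carriers `T = starSite_N ν`, `T′ = starSite_{RN} ν`.
The electric operator is NEUMANN in its own direction: its `ν`-part of the first-order two-level pairing is gan24's torus pairing
`⟨(A_ν − F_ν)z′, ·⟩` against the coarse `ν`-gradient MASKED to the `ν`-pairs inside `T` (`bmask`; P4 of leaf-01-g10 makes the junction).
gan24's window formula (`DirichletBoxPairing.Aop_sub_Fop_mulVec`) writes `((A_ν − F_ν)z′)(y)` as a weighted sum of `(∂′_νᴴ∂′_ν z′)` over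
the `2R − 2` layers astride the far `ν`-face of the block of `y`; THIS FILE splits that density as `∂′ᴴ∂′z′ = gN + gV` (`gN = 𝟙_{T′}`·NEUMANN
stencil, `gV` the WALL part) and proves: §1 `neuSt`/`gN`/`gV`, `gV_eq_zero_of_nbrs`; §2 **the windows of INTERIOR faces
(`y, y + e_ν ∈ Ω`) avoid `gV`** (`winSum_gV_eq_zero`, via gan24's `par_site_lt/ge`: window sites and their `ν`-neighbours lie in `Ω′ ⊆ T′`),
so `gV` pairs only with the NON-INTERIOR masked faces (`wall_pairs_spikes`; the spike faces `(p, p + e_ν)`, `p ∉ Ω`); §3 `nsq gN = hessN`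
(Neumann diagonal Hessian on `T′`), `nsq bmask = gradOn T ν z`, **`nsq_gV_le`** `nsq gV ≤ 4(RN)⁴·(W↑ + W↓)` and **`walls_le`**
`(RN)·(W↑ + W↓) ≤ 2·(2·nsq z′ + gradOn T′ ν z′)` (P3b's value traces); §4 ENDs **`neumann_pairing_le_mask`** (any mask),
**`neumann_pairing_le`** (electric mask): `‖⟨(A_ν − F_ν)z′, bmask z⟩‖ ≤ (2/N)·(√hessN z′·√gradOn_T z + √(nsq gV)·√spikeGrad z)`,
**`neumann_pairing_le_of_mask`** (any mask inside the electric one, e.g. leaf-01-g10's `𝟙_Ω(· + e_ν)`).  The wall term is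
`≤ (2/N)·√(8(RN)³(2‖z′‖² + gradOn′))·√spikeGrad z`, i.e. `N^{−1/2}` against the spike-row budget `N²·spikeGrad(G̃f)` (an `Ebud`-quantity:
`N·igrad_ν u(p) = Δ_tan u(p) − (Wu)(p)` on the spikes) — the rate leaf-06-g6 / this seat measured.

HONEST FRAMING (T4-DAG p. 1).  [folklore] finite lattice calculus on gan24's typed torus objects (`Aop`/`Fop`/`cWin`/`winSum`/`window_cs`
BY NAME); nothing printed is a hypothesis or a conclusion; no NE2 statement is proved here; (P-W) / (L) / `hinjK` / W3 on boxes OPEN;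
NE2 (U1a) NOT proved; spine PROVED 0/9 unchanged; NOT [B9] (3.16)/(3.23)–(3.27) as printed; NOT infinite volume, NOT a mass gap, NOT
the Clay problem, NOT summit progress.  HONEST DEPENDENCY: continuum YM on T⁴ ⇐ BetaPertH ∧ nine spine estimates (0/9 proved);
BetaPertH ⇐ (D1) ∧ (D4) ∧ CAP+tail; G-an2-4 gates asym, D1 and NE2/3/4.  No `sorry`.
-/

noncomputable section

open scoped BigOperators ComplexConjugate Matrix
open Finset

namespace Summit.QuantumFields.BalabanUV.T4Continuum.StarCarrierNeumannPairing

open Literature.MathematicalPhysics.QuantumFieldTheory.Balaban1983to89.B5Prop11Plancherel (Tor fine unitVec)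
open Literature.MathematicalPhysics.QuantumFieldTheory.Balaban1983to89.B5Action121 (sdiff sdiff_mulVec)
open Literature.MathematicalPhysics.QuantumFieldTheory.Balaban1983to89.B5Prop11Lower (nsq nsq_nonneg)
open Literature.MathematicalPhysics.QuantumFieldTheory.Balaban1983to89.B5Block118 (tstep tstep_succ)
open Summit.QuantumFields.BalabanUV.Beta.GAN24.DirichletBoxRegularity (Pdir Pdir_mulVec)
open Summit.QuantumFields.BalabanUV.Beta.GAN24.DirichletBoxPairing (Aop Fop cWin Aop_sub_Fop_mulVec)
open Summit.QuantumFields.BalabanUV.Beta.GAN24.DirichletBoxCompression (refineR)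
open Summit.QuantumFields.BalabanUV.Beta.GAN24.DirichletBoxTrace (blockReg)
open Summit.QuantumFields.BalabanUV.Beta.GAN24.DirichletBoxTwoLevelCore (site par_site_lt par_site_ge winSum window_cs refineR_blockReg_iff)
open Summit.QuantumFields.BalabanUV.T4Continuum.AlignedCarrierTrace (starSite starSite_iff)
open Summit.QuantumFields.BalabanUV.T4Continuum.CarrierColumnTrace (gradOn gradOn_nonneg trace_top_starSite trace_bottom_starSite)

variable {d : ℕ} (N R : ℕ) [NeZero N] [NeZero R] (M : Fin d → ℕ) [hM : ∀ μ, NeZero (M μ)] (S : Tor M → Prop) [DecidablePred S]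
  (ν : Fin d)

/-! ## §1 The Neumann stencil, the interior density `gN` and the wall density `gV` -/

/-- the NEUMANN second-difference stencil of the fine star carrier in its own direction:
`c̄c·([T′(x+e)](z′x − z′(x+e)) + [T′(x−e)](z′x − z′(x−e)))`, `c = RN`. [folklore] -/
def neuSt (z' : Tor (fine (R * N) M) → ℂ) (x : Tor (fine (R * N) M)) : ℂ :=
  conj (((R * N : ℕ) : ℂ)) * ((R * N : ℕ) : ℂ) *
    ((if starSite (R * N) M S ν (x + unitVec (fine (R * N) M) ν) then z' x - z' (x + unitVec (fine (R * N) M) ν) else 0)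
      + (if starSite (R * N) M S ν (x - unitVec (fine (R * N) M) ν) then z' x - z' (x - unitVec (fine (R * N) M) ν) else 0))

/-- the INTERIOR density: the Neumann stencil on `T′`, zero off `T′`. [folklore] -/
def gN (z' : Tor (fine (R * N) M) → ℂ) (x : Tor (fine (R * N) M)) : ℂ :=
  if starSite (R * N) M S ν x then neuSt N R M S ν z' x else 0

/-- the WALL density: torus second difference minus the interior density. [folklore] -/
def gV (z' : Tor (fine (R * N) M) → ℂ) (x : Tor (fine (R * N) M)) : ℂ :=
  (Pdir (fine (R * N) M) ((R * N : ℕ) : ℂ) ν *ᵥ z') x - gN N R M S ν z' x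

/-- the split of the torus second difference. [folklore] -/
theorem Pdir_eq_gN_add_gV (z' : Tor (fine (R * N) M) → ℂ) (x : Tor (fine (R * N) M)) :
    (Pdir (fine (R * N) M) ((R * N : ℕ) : ℂ) ν *ᵥ z') x = gN N R M S ν z' x + gV N R M S ν z' x := by
  rw [gV]; ring

/-- **no wall term where the site and both `ν`-neighbours are in `T′`.** [folklore] -/
theorem gV_eq_zero_of_nbrs (z' : Tor (fine (R * N) M) → ℂ) {x : Tor (fine (R * N) M)} (hx : starSite (R * N) M S ν x)
    (hp : starSite (R * N) M S ν (x + unitVec (fine (R * N) M) ν)) (hm : starSite (R * N) M S ν (x - unitVec (fine (R * N) M) ν)) :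
    gV N R M S ν z' x = 0 := by
  rw [gV, gN, if_pos hx, neuSt, if_pos hp, if_pos hm, Pdir_mulVec]
  ring

/-! ## §2 The windows of interior faces avoid the wall density -/

omit [DecidablePred S] in
/-- every window site of an INTERIOR face (both cells in `Ω`), at every height `m < 2R`, is in `Ω′ ⊆ T′`. [folklore] -/
theorem site_mem_starSite [DecidablePred S] {y : Tor (fine N M)} (hy : blockReg N M S y) (hy' : blockReg N M S (y + unitVec (fine N M) ν))
    {j : Fin d → Fin R} (hj : (j ν : ℕ) = 0) {m : ℕ} (hm : m < 2 * R) : starSite (R * N) M S ν (site N R M ν y j m) := by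
  rw [starSite_iff]
  left
  rw [← refineR_blockReg_iff N R M S]
  show blockReg N M S (BalabanAveragedTowerModes.par N R M (site N R M ν y j m))
  rcases Nat.lt_or_ge m R with h | h
  · rw [par_site_lt N R M ν y hj h]; exact hy
  · rw [par_site_ge N R M ν y hj h hm]; exact hy'

omit [NeZero N] [NeZero R] hM in
/-- window arithmetic: `site (m+1) + e = site (m+2)`, `site (m+1) − e = site m`. [folklore] -/
theorem site_succ_add (y : Tor (fine N M)) (j : Fin d → Fin R) (m : ℕ) :
    site N R M ν y j (m + 1) + unitVec (fine (R * N) M) ν = site N R M ν y j (m + 2)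
      ∧ site N R M ν y j (m + 1) - unitVec (fine (R * N) M) ν = site N R M ν y j m := by
  constructor
  · simp only [site, tstep_succ]; abel
  · simp only [site, tstep_succ]; abel

/-- **the window sum of the wall density vanishes at an interior face.** [folklore] -/
theorem winSum_gV_eq_zero (z' : Tor (fine (R * N) M) → ℂ) {y : Tor (fine N M)} (hy : blockReg N M S y)
    (hy' : blockReg N M S (y + unitVec (fine N M) ν)) : winSum N R M ν (gV N R M S ν z') y = 0 := by
  rw [winSum]
  refine Finset.sum_eq_zero fun j hj => Finset.sum_eq_zero fun m hm => ?_
  have hj' : (j ν : ℕ) = 0 := by simpa using hj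
  have hm' := Finset.mem_range.mp hm
  obtain ⟨e1, e2⟩ := site_succ_add N R M ν y j m
  have h0 := site_mem_starSite N R M S ν hy hy' hj' (m := m + 1) (by omega)
  have h1 := site_mem_starSite N R M S ν hy hy' hj' (m := m + 2) (by omega)
  have h2 := site_mem_starSite N R M S ν hy hy' hj' (m := m) (by omega)
  rw [← e1] at h1
  rw [← e2] at h2
  rw [gV_eq_zero_of_nbrs N R M S ν z' h0 h1 h2, mul_zero]

/-- the coarse `ν`-gradient under an arbitrary MASK `m` (the Neumann form of the electric operator uses `m y = [T y ∧ T (y + e_ν)]`,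
`bmask`; leaf-01-g10's P4a spells it `chi y = 𝟙_Ω(y + e_ν)`, which implies the former). [folklore] -/
def bm (m : Tor (fine N M) → Prop) [DecidablePred m] (z : Tor (fine N M) → ℂ) (y : Tor (fine N M)) : ℂ :=
  if m y then (sdiff (fine N M) (N : ℂ) ν *ᵥ z) y else 0

/-- the masked gradient restricted to the NON-INTERIOR faces (the spike faces `(p, p + e_ν)`, `p ∉ Ω`; plus gap faces at `N = 1`). [folklore] -/
def bsp (m : Tor (fine N M) → Prop) [DecidablePred m] (z : Tor (fine N M) → ℂ) (y : Tor (fine N M)) : ℂ :=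
  if (blockReg N M S y ∧ blockReg N M S (y + unitVec (fine N M) ν)) then 0 else bm N M ν m z y

/-- the ELECTRIC mask: both bonds of the `ν`-pair are star bonds. [folklore] -/
def bmask (z : Tor (fine N M) → ℂ) : Tor (fine N M) → ℂ :=
  bm N M ν (fun y => starSite N M S ν y ∧ starSite N M S ν (y + unitVec (fine N M) ν)) z

/-- **the wall density pairs only with the non-interior faces** (any mask). [folklore] -/
theorem wall_pairs_spikes (m : Tor (fine N M) → Prop) [DecidablePred m] (z' : Tor (fine (R * N) M) → ℂ) (z : Tor (fine N M) → ℂ)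
    (y : Tor (fine N M)) :
    ‖cWin d N R * winSum N R M ν (gV N R M S ν z') y‖ * ‖bm N M ν m z y‖
      = ‖cWin d N R * winSum N R M ν (gV N R M S ν z') y‖ * ‖bsp N M S ν m z y‖ := by
  rw [bsp]
  split_ifs with h
  · rw [winSum_gV_eq_zero N R M S ν z' h.1 h.2, mul_zero, norm_zero, zero_mul, zero_mul]
  · rfl

/-! ## §3 The budgets of the three densities -/

/-- the NEUMANN diagonal Hessian energy of the fine field on `T′` in direction `ν`. [folklore] -/
def hessN (z' : Tor (fine (R * N) M) → ℂ) : ℝ := ∑ x ∈ univ.filter (starSite (R * N) M S ν), ‖neuSt N R M S ν z' x‖ ^ 2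

/-- `nsq gN = hessN`. [folklore] -/
theorem nsq_gN_eq (z' : Tor (fine (R * N) M) → ℂ) : nsq (gN N R M S ν z') = hessN N R M S ν z' := by
  rw [nsq, hessN, Finset.sum_filter]
  refine Finset.sum_congr rfl fun x _ => ?_
  unfold gN
  split_ifs <;> simp

/-- `nsq bmask = gradOn T ν z` (the electric mask). [folklore] -/
theorem nsq_bmask_eq (z : Tor (fine N M) → ℂ) : nsq (bmask N M S ν z) = gradOn N M (starSite N M S ν) ν z := by
  rw [nsq, gradOn, Finset.sum_filter]
  refine Finset.sum_congr rfl fun y _ => ?_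
  unfold bmask bm
  split_ifs <;> simp

/-- a mask INSIDE the electric mask has `nsq (bm m z) ≤ gradOn T ν z`. [folklore] -/
theorem nsq_bm_le (m : Tor (fine N M) → Prop) [DecidablePred m]
    (hm : ∀ y, m y → starSite N M S ν y ∧ starSite N M S ν (y + unitVec (fine N M) ν)) (z : Tor (fine N M) → ℂ) :
    nsq (bm N M ν m z) ≤ gradOn N M (starSite N M S ν) ν z := by
  rw [← nsq_bmask_eq N M S ν z, nsq, nsq]
  refine Finset.sum_le_sum fun y _ => ?_
  unfold bmask bm
  by_cases h : m y
  · rw [if_pos h, if_pos (hm y h)]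
  · rw [if_neg h, norm_zero, zero_pow two_ne_zero]; positivity

/-- the masked gradient energy on the NON-INTERIOR faces under the electric mask (`N²·spikeGrad` is the spike-row budget of P5). [folklore] -/
def spikeGrad (z : Tor (fine N M) → ℂ) : ℝ :=
  nsq (bsp N M S ν (fun y => starSite N M S ν y ∧ starSite N M S ν (y + unitVec (fine N M) ν)) z)

/-- a mask inside the electric mask has `nsq (bsp m z) ≤ spikeGrad z`. [folklore] -/
theorem nsq_bsp_le (m : Tor (fine N M) → Prop) [DecidablePred m]
    (hm : ∀ y, m y → starSite N M S ν y ∧ starSite N M S ν (y + unitVec (fine N M) ν)) (z : Tor (fine N M) → ℂ) :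
    nsq (bsp N M S ν m z) ≤ spikeGrad N M S ν z := by
  rw [spikeGrad, nsq, nsq]
  refine Finset.sum_le_sum fun y _ => ?_
  unfold bsp bm
  by_cases hI : blockReg N M S y ∧ blockReg N M S (y + unitVec (fine N M) ν)
  · rw [if_pos hI, if_pos hI]
  · rw [if_neg hI, if_neg hI]
    by_cases h : m y
    · rw [if_pos h, if_pos (hm y h)]
    · rw [if_neg h, norm_zero, zero_pow two_ne_zero]; positivity

omit [DecidablePred S] in
/-- leaf-01-g10's mask `𝟙_Ω(· + e_ν)` lies inside the electric mask. [folklore] -/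
theorem chi_le_mask (y : Tor (fine N M)) (h : blockReg N M S (y + unitVec (fine N M) ν)) :
    starSite N M S ν y ∧ starSite N M S ν (y + unitVec (fine N M) ν) := by
  rw [starSite_iff, starSite_iff]
  exact ⟨Or.inr h, Or.inl h⟩

/-- the ℓ²-mass of the fine field on the TOP wall layer of `T′`. [folklore] -/
def wallUp (z' : Tor (fine (R * N) M) → ℂ) : ℝ :=
  ∑ x ∈ univ.filter (fun x => starSite (R * N) M S ν x ∧ ¬ starSite (R * N) M S ν (x + unitVec (fine (R * N) M) ν)), ‖z' x‖ ^ 2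

/-- the ℓ²-mass of the fine field on the BOTTOM wall layer (inward spikes) of `T′`. [folklore] -/
def wallDn (z' : Tor (fine (R * N) M) → ℂ) : ℝ :=
  ∑ x ∈ univ.filter (fun x => starSite (R * N) M S ν x ∧ ¬ starSite (R * N) M S ν (x - unitVec (fine (R * N) M) ν)), ‖z' x‖ ^ 2

/-- pointwise bound of the wall density at a carrier site: `‖gV x‖² ≤ 2c⁴·([x+e ∉ T′] + [x−e ∉ T′])·‖z′x‖²`. [folklore] -/
theorem normSq_gV_le_of_mem {z' : Tor (fine (R * N) M) → ℂ} (hz' : ∀ x, ¬ starSite (R * N) M S ν x → z' x = 0)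
    {x : Tor (fine (R * N) M)} (hx : starSite (R * N) M S ν x) :
    ‖gV N R M S ν z' x‖ ^ 2 ≤ 2 * ((R * N : ℕ) : ℝ) ^ 4 *
      (((if starSite (R * N) M S ν (x + unitVec (fine (R * N) M) ν) then (0 : ℝ) else 1)
        + (if starSite (R * N) M S ν (x - unitVec (fine (R * N) M) ν) then (0 : ℝ) else 1)) * ‖z' x‖ ^ 2) := by
  have hc : ‖conj (((R * N : ℕ) : ℂ)) * ((R * N : ℕ) : ℂ)‖ = ((R * N : ℕ) : ℝ) ^ 2 := by
    rw [norm_mul, Complex.norm_conj, Complex.norm_natCast]; ring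
  rw [gV, gN, if_pos hx, neuSt, Pdir_mulVec]
  by_cases hp : starSite (R * N) M S ν (x + unitVec (fine (R * N) M) ν) <;>
    by_cases hm : starSite (R * N) M S ν (x - unitVec (fine (R * N) M) ν)
  · rw [if_pos hp, if_pos hm, if_pos hp, if_pos hm]
    have : conj (((R * N : ℕ) : ℂ)) * ((R * N : ℕ) : ℂ) * (2 * z' x - z' (x + unitVec (fine (R * N) M) ν) - z' (x - unitVec (fine (R * N) M) ν))
        - conj (((R * N : ℕ) : ℂ)) * ((R * N : ℕ) : ℂ) * ((z' x - z' (x + unitVec (fine (R * N) M) ν)) + (z' x - z' (x - unitVec (fine (R * N) M) ν))) = 0 := by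
      ring
    rw [this]; simp
  · rw [if_pos hp, if_neg hm, if_pos hp, if_neg hm, hz' _ hm]
    have : conj (((R * N : ℕ) : ℂ)) * ((R * N : ℕ) : ℂ) * (2 * z' x - z' (x + unitVec (fine (R * N) M) ν) - 0)
        - conj (((R * N : ℕ) : ℂ)) * ((R * N : ℕ) : ℂ) * ((z' x - z' (x + unitVec (fine (R * N) M) ν)) + 0)
        = conj (((R * N : ℕ) : ℂ)) * ((R * N : ℕ) : ℂ) * z' x := by ring
    rw [this, norm_mul, hc]; nlinarith [norm_nonneg (z' x), sq_nonneg (((R * N : ℕ) : ℝ) ^ 2 * ‖z' x‖)]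
  · rw [if_neg hp, if_pos hm, if_neg hp, if_pos hm, hz' _ hp]
    have : conj (((R * N : ℕ) : ℂ)) * ((R * N : ℕ) : ℂ) * (2 * z' x - 0 - z' (x - unitVec (fine (R * N) M) ν))
        - conj (((R * N : ℕ) : ℂ)) * ((R * N : ℕ) : ℂ) * (0 + (z' x - z' (x - unitVec (fine (R * N) M) ν)))
        = conj (((R * N : ℕ) : ℂ)) * ((R * N : ℕ) : ℂ) * z' x := by ring
    rw [this, norm_mul, hc]; nlinarith [norm_nonneg (z' x), sq_nonneg (((R * N : ℕ) : ℝ) ^ 2 * ‖z' x‖)]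
  · rw [if_neg hp, if_neg hm, if_neg hp, if_neg hm, hz' _ hp, hz' _ hm]
    have : conj (((R * N : ℕ) : ℂ)) * ((R * N : ℕ) : ℂ) * (2 * z' x - 0 - 0)
        - conj (((R * N : ℕ) : ℂ)) * ((R * N : ℕ) : ℂ) * (0 + 0)
        = 2 * (conj (((R * N : ℕ) : ℂ)) * ((R * N : ℕ) : ℂ) * z' x) := by ring
    rw [this, norm_mul, norm_mul, hc, Complex.norm_two]
    nlinarith [norm_nonneg (z' x), sq_nonneg (((R * N : ℕ) : ℝ) ^ 2 * ‖z' x‖)]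

/-- pointwise bound of the wall density OFF the carrier: `‖gV x‖² ≤ 2c⁴·(‖z′(x+e)‖² + ‖z′(x−e)‖²)`. [folklore] -/
theorem normSq_gV_le_of_not_mem {z' : Tor (fine (R * N) M) → ℂ} (hz' : ∀ x, ¬ starSite (R * N) M S ν x → z' x = 0)
    {x : Tor (fine (R * N) M)} (hx : ¬ starSite (R * N) M S ν x) :
    ‖gV N R M S ν z' x‖ ^ 2 ≤ 2 * ((R * N : ℕ) : ℝ) ^ 4 *
      (‖z' (x + unitVec (fine (R * N) M) ν)‖ ^ 2 + ‖z' (x - unitVec (fine (R * N) M) ν)‖ ^ 2) := by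
  rw [gV, gN, if_neg hx, sub_zero, Pdir_mulVec, hz' _ hx, mul_zero, zero_sub]
  have e : ‖conj (((R * N : ℕ) : ℂ)) * ((R * N : ℕ) : ℂ) *
      (-z' (x + unitVec (fine (R * N) M) ν) - z' (x - unitVec (fine (R * N) M) ν))‖
      = ((R * N : ℕ) : ℝ) ^ 2 * ‖z' (x + unitVec (fine (R * N) M) ν) + z' (x - unitVec (fine (R * N) M) ν)‖ := by
    rw [norm_mul, norm_mul, Complex.norm_conj, Complex.norm_natCast, ← neg_add', norm_neg]; ring
  rw [e, mul_pow]
  have h := norm_add_le (z' (x + unitVec (fine (R * N) M) ν)) (z' (x - unitVec (fine (R * N) M) ν))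
  have hc : (0 : ℝ) ≤ (((R * N : ℕ) : ℝ) ^ 2) ^ 2 := by positivity
  nlinarith [mul_le_mul_of_nonneg_left (pow_le_pow_left₀ (norm_nonneg _) h 2) hc,
    sq_nonneg (‖z' (x + unitVec (fine (R * N) M) ν)‖ - ‖z' (x - unitVec (fine (R * N) M) ν)‖)]

/-- **THE WALL DENSITY IS CARRIED BY THE TWO WALL LAYERS**: `nsq gV ≤ 4(RN)⁴·(W↑ + W↓)`. [folklore] -/
theorem nsq_gV_le {z' : Tor (fine (R * N) M) → ℂ} (hz' : ∀ x, ¬ starSite (R * N) M S ν x → z' x = 0) :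
    nsq (gV N R M S ν z') ≤ 4 * ((R * N : ℕ) : ℝ) ^ 4 * (wallUp N R M S ν z' + wallDn N R M S ν z') := by
  have hpt : ∀ x, ‖gV N R M S ν z' x‖ ^ 2 ≤ 2 * ((R * N : ℕ) : ℝ) ^ 4 *
      (((if (starSite (R * N) M S ν x ∧ ¬ starSite (R * N) M S ν (x + unitVec (fine (R * N) M) ν)) then ‖z' x‖ ^ 2 else 0)
        + (if (starSite (R * N) M S ν x ∧ ¬ starSite (R * N) M S ν (x - unitVec (fine (R * N) M) ν)) then ‖z' x‖ ^ 2 else 0))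
      + ((if (starSite (R * N) M S ν (x + unitVec (fine (R * N) M) ν) ∧ ¬ starSite (R * N) M S ν x)
            then ‖z' (x + unitVec (fine (R * N) M) ν)‖ ^ 2 else 0)
        + (if (starSite (R * N) M S ν (x - unitVec (fine (R * N) M) ν) ∧ ¬ starSite (R * N) M S ν x)
            then ‖z' (x - unitVec (fine (R * N) M) ν)‖ ^ 2 else 0))) := by
    intro x
    by_cases hx : starSite (R * N) M S ν x
    · have h := normSq_gV_le_of_mem N R M S ν hz' hx
      rw [if_neg (fun h' : starSite (R * N) M S ν (x + unitVec (fine (R * N) M) ν) ∧ ¬ starSite (R * N) M S ν x => h'.2 hx),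
        if_neg (fun h' : starSite (R * N) M S ν (x - unitVec (fine (R * N) M) ν) ∧ ¬ starSite (R * N) M S ν x => h'.2 hx)]
      by_cases hp : starSite (R * N) M S ν (x + unitVec (fine (R * N) M) ν) <;>
        by_cases hm : starSite (R * N) M S ν (x - unitVec (fine (R * N) M) ν)
      · rw [if_pos hp, if_pos hm] at h
        rw [if_neg (by exact fun h' => h'.2 hp), if_neg (by exact fun h' => h'.2 hm)]
        exact h.trans (le_of_eq (by ring))
      · rw [if_pos hp, if_neg hm] at h
        rw [if_neg (by exact fun h' => h'.2 hp), if_pos ⟨hx, hm⟩]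
        exact h.trans (le_of_eq (by ring))
      · rw [if_neg hp, if_pos hm] at h
        rw [if_pos ⟨hx, hp⟩, if_neg (by exact fun h' => h'.2 hm)]
        exact h.trans (le_of_eq (by ring))
      · rw [if_neg hp, if_neg hm] at h
        rw [if_pos ⟨hx, hp⟩, if_pos ⟨hx, hm⟩]
        exact h.trans (le_of_eq (by ring))
    · have h := normSq_gV_le_of_not_mem N R M S ν hz' hx
      rw [if_neg (by exact fun h' => hx h'.1), if_neg (by exact fun h' => hx h'.1)]
      by_cases hp : starSite (R * N) M S ν (x + unitVec (fine (R * N) M) ν) <;>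
        by_cases hm : starSite (R * N) M S ν (x - unitVec (fine (R * N) M) ν)
      · rw [if_pos ⟨hp, hx⟩, if_pos ⟨hm, hx⟩]
        exact h.trans (le_of_eq (by ring))
      · rw [hz' _ hm, norm_zero] at h
        rw [if_pos ⟨hp, hx⟩, if_neg (by exact fun h' => hm h'.1)]
        exact h.trans (le_of_eq (by ring))
      · rw [hz' _ hp, norm_zero] at h
        rw [if_neg (by exact fun h' => hp h'.1), if_pos ⟨hm, hx⟩]
        exact h.trans (le_of_eq (by ring))
      · rw [hz' _ hp, hz' _ hm, norm_zero] at h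
        rw [if_neg (by exact fun h' => hp h'.1), if_neg (by exact fun h' => hm h'.1)]
        exact h.trans (le_of_eq (by ring))
  have hU : ∑ x, (if (starSite (R * N) M S ν x ∧ ¬ starSite (R * N) M S ν (x + unitVec (fine (R * N) M) ν)) then ‖z' x‖ ^ 2
      else (0 : ℝ)) = wallUp N R M S ν z' := by
    rw [wallUp, Finset.sum_filter]
  have hD : ∑ x, (if (starSite (R * N) M S ν x ∧ ¬ starSite (R * N) M S ν (x - unitVec (fine (R * N) M) ν)) then ‖z' x‖ ^ 2
      else (0 : ℝ)) = wallDn N R M S ν z' := by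
    rw [wallDn, Finset.sum_filter]
  have hU' : ∑ x, (if (starSite (R * N) M S ν (x - unitVec (fine (R * N) M) ν) ∧ ¬ starSite (R * N) M S ν x)
      then ‖z' (x - unitVec (fine (R * N) M) ν)‖ ^ 2 else (0 : ℝ)) = wallUp N R M S ν z' := by
    rw [wallUp, Finset.sum_filter]
    exact Fintype.sum_equiv (Equiv.subRight (unitVec (fine (R * N) M) ν)) _ _ (fun x => by
      simp only [Equiv.subRight_apply, sub_add_cancel])
  have hD' : ∑ x, (if (starSite (R * N) M S ν (x + unitVec (fine (R * N) M) ν) ∧ ¬ starSite (R * N) M S ν x)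
      then ‖z' (x + unitVec (fine (R * N) M) ν)‖ ^ 2 else (0 : ℝ)) = wallDn N R M S ν z' := by
    rw [wallDn, Finset.sum_filter]
    exact Fintype.sum_equiv (Equiv.addRight (unitVec (fine (R * N) M) ν)) _ _ (fun x => by
      simp only [Equiv.coe_addRight, add_sub_cancel_right])
  calc nsq (gV N R M S ν z') = ∑ x, ‖gV N R M S ν z' x‖ ^ 2 := rfl
    _ ≤ _ := Finset.sum_le_sum fun x _ => hpt x
    _ = 2 * ((R * N : ℕ) : ℝ) ^ 4 * ((wallUp N R M S ν z' + wallDn N R M S ν z') + (wallDn N R M S ν z' + wallUp N R M S ν z')) := by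
        rw [← Finset.mul_sum, Finset.sum_add_distrib, Finset.sum_add_distrib, Finset.sum_add_distrib, hU, hD, hU', hD']
    _ = 4 * ((R * N : ℕ) : ℝ) ^ 4 * (wallUp N R M S ν z' + wallDn N R M S ν z') := by ring

/-- **and the wall layers are small by the value traces of P3b**: `(RN)·(W↑ + W↓) ≤ 2·(2·nsq z′ + gradOn T′ ν z′)`. [folklore] -/
theorem walls_le (z' : Tor (fine (R * N) M) → ℂ) :
    ((R * N : ℕ) : ℝ) * (wallUp N R M S ν z' + wallDn N R M S ν z') ≤ 2 * (2 * nsq z' + gradOn (R * N) M (starSite (R * N) M S ν) ν z') := by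
  have h1 := trace_top_starSite (R * N) M S ν z'
  have h2 := trace_bottom_starSite (R * N) M S ν z'
  rw [wallUp, wallDn, mul_add]
  linarith

/-! ## §4 The END: the Neumann direction of the two-level pairing -/

/-- **THE NEUMANN DIRECTION OF (P-gaffney), any mask**: for `z′` (any field; the support enters only the wall budget `nsq_gV_le`) and
any coarse `z`, `‖⟨(A_ν − F_ν)z′, b_m z⟩‖ ≤ (2/N)·(√hessN z′·√nsq(b_m z) + √(nsq gV)·√nsq(bsp_m z))` — the interior window term against
the Neumann Hessian and the WALL term, which pairs only with the non-interior faces. [folklore] -/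
theorem neumann_pairing_le_mask (m : Tor (fine N M) → Prop) [DecidablePred m] (z' : Tor (fine (R * N) M) → ℂ)
    (z : Tor (fine N M) → ℂ) :
    ‖star ((Aop N R M ν - Fop N R M ν) *ᵥ z') ⬝ᵥ (bm N M ν m z)‖
      ≤ 2 / (N : ℝ) * (Real.sqrt (hessN N R M S ν z') * Real.sqrt (nsq (bm N M ν m z))
          + Real.sqrt (nsq (gV N R M S ν z')) * Real.sqrt (nsq (bsp N M S ν m z))) := by
  set a := (Aop N R M ν - Fop N R M ν) *ᵥ z' with ha
  set b := bm N M ν m z with hb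
  have h1 : ‖star a ⬝ᵥ b‖ ≤ ∑ y, ‖a y‖ * ‖b y‖ := by
    refine (norm_sum_le _ _).trans (Finset.sum_le_sum fun y _ => ?_)
    rw [Pi.star_apply, norm_mul, norm_star]
  have hsplit : ∀ y, a y = cWin d N R * winSum N R M ν (gN N R M S ν z') y + cWin d N R * winSum N R M ν (gV N R M S ν z') y := by
    intro y
    rw [ha, Aop_sub_Fop_mulVec, ← mul_add, winSum, winSum, ← Finset.sum_add_distrib]
    congr 1
    refine Finset.sum_congr rfl fun j _ => ?_
    rw [← Finset.sum_add_distrib]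
    refine Finset.sum_congr rfl fun n _ => ?_
    rw [← mul_add, site, Pdir_eq_gN_add_gV N R M S ν z']
  have h2 : ∑ y, ‖a y‖ * ‖b y‖ ≤ ∑ y, ‖cWin d N R * winSum N R M ν (gN N R M S ν z') y‖ * ‖b y‖
      + ∑ y, ‖cWin d N R * winSum N R M ν (gV N R M S ν z') y‖ * ‖bsp N M S ν m z y‖ := by
    rw [← Finset.sum_add_distrib]
    refine Finset.sum_le_sum fun y _ => ?_
    rw [hb, ← wall_pairs_spikes N R M S ν m z' z y, ← add_mul]
    refine mul_le_mul_of_nonneg_right ?_ (norm_nonneg _)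
    rw [hsplit y]
    exact norm_add_le _ _
  have hI := window_cs N R M ν (gN N R M S ν z') b
  have hE := window_cs N R M ν (gV N R M S ν z') (bsp N M S ν m z)
  rw [nsq_gN_eq N R M S ν z'] at hI
  calc ‖star a ⬝ᵥ b‖ ≤ _ := h1
    _ ≤ _ := h2
    _ ≤ 2 / (N : ℝ) * (Real.sqrt (hessN N R M S ν z') * Real.sqrt (nsq b))
          + 2 / (N : ℝ) * (Real.sqrt (nsq (gV N R M S ν z')) * Real.sqrt (nsq (bsp N M S ν m z))) := add_le_add hI hE
    _ = _ := by ring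

/-- **THE NEUMANN DIRECTION OF (P-gaffney), electric mask**: `‖⟨(A_ν − F_ν)z′, bmask z⟩‖ ≤ (2/N)·(√hessN z′·√gradOn_T z +
√(nsq gV)·√spikeGrad z)`; with `nsq_gV_le` + `walls_le` the wall term is `(2/N)·√(8(RN)³(2‖z′‖² + gradOn′))·√spikeGrad`, i.e. `N^{−1/2}`
against the spike-row budget `N²·spikeGrad`. [folklore] -/
theorem neumann_pairing_le (z' : Tor (fine (R * N) M) → ℂ) (z : Tor (fine N M) → ℂ) :
    ‖star ((Aop N R M ν - Fop N R M ν) *ᵥ z') ⬝ᵥ (bmask N M S ν z)‖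
      ≤ 2 / (N : ℝ) * (Real.sqrt (hessN N R M S ν z') * Real.sqrt (gradOn N M (starSite N M S ν) ν z)
          + Real.sqrt (nsq (gV N R M S ν z')) * Real.sqrt (spikeGrad N M S ν z)) := by
  have h := neumann_pairing_le_mask N R M S ν (fun y => starSite N M S ν y ∧ starSite N M S ν (y + unitVec (fine N M) ν)) z' z
  rw [← nsq_bmask_eq N M S ν z]
  exact h

/-- **… and for any mask inside the electric one** (leaf-01-g10's `𝟙_Ω(· + e_ν)` via `chi_le_mask`): the same bound with the
electric budgets `gradOn_T` / `spikeGrad`. [folklore] -/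
theorem neumann_pairing_le_of_mask (m : Tor (fine N M) → Prop) [DecidablePred m]
    (hm : ∀ y, m y → starSite N M S ν y ∧ starSite N M S ν (y + unitVec (fine N M) ν))
    (z' : Tor (fine (R * N) M) → ℂ) (z : Tor (fine N M) → ℂ) :
    ‖star ((Aop N R M ν - Fop N R M ν) *ᵥ z') ⬝ᵥ (bm N M ν m z)‖
      ≤ 2 / (N : ℝ) * (Real.sqrt (hessN N R M S ν z') * Real.sqrt (gradOn N M (starSite N M S ν) ν z)
          + Real.sqrt (nsq (gV N R M S ν z')) * Real.sqrt (spikeGrad N M S ν z)) := by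
  have hNpos : (0 : ℝ) < N := by exact_mod_cast Nat.pos_of_ne_zero (NeZero.ne N)
  refine (neumann_pairing_le_mask N R M S ν m z' z).trans (mul_le_mul_of_nonneg_left ?_ (by positivity))
  gcongr
  · exact nsq_bm_le N M S ν m hm z
  · exact nsq_bsp_le N M S ν m hm z

end Summit.QuantumFields.BalabanUV.T4Continuum.StarCarrierNeumannPairing

end
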